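import Mathlib
import HarnessLib
import Summits.HubbardSuperconductivity.HubbardSuperconductivity.Theorems.KLProgrammeC4aLatticeMomentumSum
import Summits.HubbardSuperconductivity.HubbardSuperconductivity.Theorems.KLProgrammeKLRegimeSplitPredicates

/-!
# K3 gen-8-FLOW (stmt 20437, stub (C), located risk «(C)-B-REP», sup/aliasing route, p2 side (R59bl)): the BRIDGE
# «`torusCosCoeff L (Φ∘p) x` = continuum cosine coefficient + ALIASED Fourier coefficients» (Poisson summation on the Brillouin-zone grid)

Cell gate-hubbard-kl, seat p2 g13 (memo `B-CT-DESIGN-p2g13.md` §3; pen (R59bl): c4a-1 owns the generic aliasing-jet lemma, p2 the bridge + factors + assembly).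
The symmetrised interpolant reads lattice data through its cosine coefficients `f_c(x) = L⁻² Σ_k f(k) cos(p_k·x̃)` (`torusCosCoeff`, `eval_symInterp`,
`…EngineReadingJetFunctional.iteratedFDeriv_evalM_symInterp_apply`).  When the data are the lattice SAMPLES `f = Φ∘p` of a smooth `2π`-periodic function `Φ` on the
momentum plane, `f_c(x)` is the GRID AVERAGE of the smooth periodic function `Ψ_x(q) = Φ(q)·cos(q·x̃)` (`x̃ ∈ ℤ²` the centred representative), so c4a-1's
LAYER-2 bridge (`…C4aLatticeMomentumSum.sum_latticeMomentum_eq` / `norm_latticeMomentumAvg_sub_zoneIntegral_le`, Poisson summation on `(2π/L)ℤ_L²`) applies: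

* §1 `Ψ_x` is smooth and `2π`-periodic (`contDiff_mul_cosSite`, `periodic_mul_cosSite`; the frequency vector `siteFreq x = (x̃₀, x̃₁)` is RESOLVED by the grid:
  `two_mul_abs_siteFreq_le`, `2|x̃ᵢ| ≤ L`, the hypothesis of `Literature.….tsum_aliased_norm_mFourierCoeff_trigPoly_mul_le'`);
* §2 `torusCosCoeff_sample_eq_gridAvg` — `(f_c(x) : ℂ) = L⁻²·Σ_k Ψ_x(p_k)`;
  **`torusCosCoeff_sample_eq_tsum_aliased`** — `(f_c(x) : ℂ) = Σ_{m : L ∣ m} 𝓕(Ψ_x♭)(m)` EXACTLY (`Ψ_x♭` the descent of `y ↦ Ψ_x(2πy)` to `(ℝ/ℤ)²`);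
  **`norm_torusCosCoeff_sample_sub_zoneCoeff_le`** — `‖(f_c(x) : ℂ) − (2π)⁻²∫_{[−π,π)²} Φ(q)cos(q·x̃) dq‖ ≤ Σ_{m ≠ 0, L ∣ m} ‖𝓕(Ψ_x♭)(m)‖` — the cosine coefficient of
  the samples is the CONTINUUM cosine coefficient up to the aliased coefficients of `Ψ_x`.
What c4a-1's generic lemma adds on top (not here): `Ψ_x = ½(e_{x̃} + e_{−x̃})·Φ` with `e_{±x̃}` resolved ⇒ aliased tail `≤ tail_{L/2}(𝓕Φ♭)`
(`tsum_aliased_norm_mFourierCoeff_trigPoly_mul_le'`), the tail from `‖D^M Φ‖` (`tsum_tail_norm_mFourierCoeff_descend_le`), and the resummation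
`Σ_x c_x̃ Dʲh_x(q) = Dʲ[box-truncated Fourier series](q)` for `D₄`-symmetric `Φ`.
Proofs only; no definitions beyond local abbreviations in statements; nothing about the model is asserted.  References: Boyd 2001 §4.5 Thm 19–20 [cite: Boyd2001];
BGM 2006 §2.3 (2.17) [cite: BenfattoGiulianiMastropietro2006].
-/

noncomputable section

namespace Summit.HubbardSuperconductivity.HubbardSuperconductivity.Theorems.EngineV8

set_option linter.dupNamespace false -- summit = problem name (single-conjunct summit), D-0017

open Real Set MeasureTheory UnitAddTorus
open Literature.Probability.LatticeModels Literature.MathematicalPhysics.QuantumLattice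
open Literature.Analysis.Fourier Literature.Analysis.FunctionSpaces
open Summit.HubbardSuperconductivity.HubbardSuperconductivity.Theorems.KLRegimeSplit
open Summit.HubbardSuperconductivity.HubbardSuperconductivity.Theorems.C4a

variable {L : ℕ} [NeZero L]

/-! ## §1 The cosine-weighted integrand `Ψ_x(q) = Φ(q)·cos(q·x̃)` -/

omit [NeZero L] in
/-- `Ψ_x` is smooth when `Φ` is. -/
theorem contDiff_mul_cosSite {Φ : Momentum → ℂ} (hΦ : ContDiff ℝ (⊤ : ℕ∞) Φ) (x : TorusSite 2 L) :
    ContDiff ℝ (⊤ : ℕ∞) fun q : Momentum => Φ q * ((Real.cos (∑ i : Fin 2, q i * ((x i).valMinAbs : ℝ)) : ℝ) : ℂ) := by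
  have hlin : ∀ i : Fin 2, ContDiff ℝ (⊤ : ℕ∞) (fun q : Momentum => q i) := fun i => (EuclideanSpace.proj (𝕜 := ℝ) i).contDiff
  have hs : ContDiff ℝ (⊤ : ℕ∞) (fun q : Momentum => ∑ i : Fin 2, q i * ((x i).valMinAbs : ℝ)) :=
    ContDiff.sum fun i _ => (hlin i).mul contDiff_const
  exact hΦ.mul (Complex.ofRealCLM.contDiff.comp (Real.contDiff_cos.comp hs))

omit [NeZero L] in
/-- `Ψ_x` is `2π`-periodic in each momentum coordinate when `Φ` is (`x̃ᵢ ∈ ℤ`). -/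
theorem periodic_mul_cosSite {Φ : Momentum → ℂ} (hper : ∀ (j : Fin 2) (q : Momentum), Φ (q + EuclideanSpace.single j (2 * π)) = Φ q)
    (x : TorusSite 2 L) (j : Fin 2) (q : Momentum) :
    Φ (q + EuclideanSpace.single j (2 * π)) * ((Real.cos (∑ i : Fin 2, (q + EuclideanSpace.single j (2 * π)) i * ((x i).valMinAbs : ℝ)) : ℝ) : ℂ) =
      Φ q * ((Real.cos (∑ i : Fin 2, q i * ((x i).valMinAbs : ℝ)) : ℝ) : ℂ) := by
  have hsum : ∑ i : Fin 2, (q + EuclideanSpace.single j (2 * π)) i * ((x i).valMinAbs : ℝ) =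
      (∑ i : Fin 2, q i * ((x i).valMinAbs : ℝ)) + ((x j).valMinAbs : ℤ) * (2 * π) := by
    simp only [PiLp.add_apply, PiLp.single_apply, add_mul, Finset.sum_add_distrib, ite_mul, zero_mul, Finset.sum_ite_eq', Finset.mem_univ,
      if_true]
    ring
  rw [hper, hsum, Real.cos_add_int_mul_two_pi]

/-- **The site frequency is resolved by the grid**: `2|x̃ᵢ| ≤ L` for the centred representative. -/
theorem two_mul_abs_siteFreq_le (x : TorusSite 2 L) (i : Fin 2) : 2 * |((x i).valMinAbs : ℤ)| ≤ L := by
  have h := ZMod.natAbs_valMinAbs_le (x i)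
  have h2 : (((x i).valMinAbs).natAbs : ℤ) = |(x i).valMinAbs| := Int.natCast_natAbs _
  omega

/-! ## §2 The cosine coefficient of the samples = grid average of `Ψ_x` = the continuum coefficient + the aliased coefficients -/

/-- **The cosine coefficient of lattice samples is the grid average of `Ψ_x`**: `(f_c(x) : ℂ) = L⁻²·Σ_k Ψ_x(p_k)` for `f = Φ∘p` (real `Φ`). -/
theorem torusCosCoeff_sample_eq_gridAvg (Φ : Momentum → ℝ) (x : TorusSite 2 L) :
    ((torusCosCoeff L (fun k => Φ (WithLp.toLp 2 (latticeMomentum L k))) x : ℝ) : ℂ) =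
      ((L : ℂ) ^ 2)⁻¹ * ∑ k : TorusSite 2 L,
        (fun q : Momentum => ((Φ q : ℝ) : ℂ) * ((Real.cos (∑ i : Fin 2, q i * ((x i).valMinAbs : ℝ)) : ℝ) : ℂ)) (WithLp.toLp 2 (latticeMomentum L k)) := by
  simp only [torusCosCoeff]
  push_cast
  rfl

section Poisson

variable {Φ : Momentum → ℝ} (hΦ : ContDiff ℝ (⊤ : ℕ∞) Φ)
  (hper : ∀ (j : Fin 2) (q : Momentum), Φ (q + EuclideanSpace.single j (2 * π)) = Φ q)
include hΦ hper

omit hper in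
/-- The complexified `Φ` is smooth. -/
theorem contDiff_ofReal_comp : ContDiff ℝ (⊤ : ℕ∞) fun q : Momentum => ((Φ q : ℝ) : ℂ) := Complex.ofRealCLM.contDiff.comp hΦ

omit hΦ in
/-- The complexified `Φ` is `2π`-periodic. -/
theorem periodic_ofReal_comp (j : Fin 2) (q : Momentum) :
    (((Φ (q + EuclideanSpace.single j (2 * π)) : ℝ) : ℂ)) = ((Φ q : ℝ) : ℂ) := by
  rw [hper]

/-- **POISSON FORM OF THE COSINE COEFFICIENT OF SAMPLES**: `(f_c(x) : ℂ) = Σ_{m : L ∣ m} 𝓕(Ψ_x♭)(m)` exactly, `Ψ_x♭` the descent of `y ↦ Ψ_x(2πy)` to the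
unit torus. [cite: Boyd2001, §4.5 Theorem 19 (4.44)] -/
theorem torusCosCoeff_sample_eq_tsum_aliased (x : TorusSite 2 L) :
    ((torusCosCoeff L (fun k => Φ (WithLp.toLp 2 (latticeMomentum L k))) x : ℝ) : ℂ) =
      ∑' m : Fin 2 → ℤ, (if ∀ i, (L : ℤ) ∣ m i then
        mFourierCoeff (Torus.descend
          (fun y : Momentum => (fun q : Momentum => ((Φ q : ℝ) : ℂ) * ((Real.cos (∑ i : Fin 2, q i * ((x i).valMinAbs : ℝ)) : ℝ) : ℂ)) ((2 * π) • y))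
          (isLatticePeriodic_rescale
            (Φ := fun q : Momentum => ((Φ q : ℝ) : ℂ) * ((Real.cos (∑ i : Fin 2, q i * ((x i).valMinAbs : ℝ)) : ℝ) : ℂ))
            (periodic_mul_cosSite (Φ := fun q : Momentum => ((Φ q : ℝ) : ℂ)) (periodic_ofReal_comp hper) x))) m else 0) := by
  have hL : (L : ℂ) ≠ 0 := by exact_mod_cast NeZero.ne L
  rw [torusCosCoeff_sample_eq_gridAvg, sum_latticeMomentum_eq (contDiff_mul_cosSite (contDiff_ofReal_comp hΦ) x)
    (periodic_mul_cosSite (Φ := fun q : Momentum => ((Φ q : ℝ) : ℂ)) (periodic_ofReal_comp hper) x), ← mul_assoc,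
    inv_mul_cancel₀ (pow_ne_zero 2 hL), one_mul]

/-- **THE COSINE COEFFICIENT OF SAMPLES IS THE CONTINUUM COSINE COEFFICIENT UP TO THE ALIASED COEFFICIENTS**:
`‖(f_c(x) : ℂ) − (2π)⁻²·∫_{[−π,π)²} Φ(q)cos(q·x̃) dq‖ ≤ Σ_{m ≠ 0, L ∣ m} ‖𝓕(Ψ_x♭)(m)‖`. [cite: Boyd2001, §4.5 Theorem 20 (4.47)] -/
theorem norm_torusCosCoeff_sample_sub_zoneCoeff_le (x : TorusSite 2 L) :
    ‖((torusCosCoeff L (fun k => Φ (WithLp.toLp 2 (latticeMomentum L k))) x : ℝ) : ℂ) -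
        ((2 * π) ^ 2)⁻¹ • ∫ p in Ico (-π) π ×ˢ Ico (-π) π,
          (fun q : Momentum => ((Φ q : ℝ) : ℂ) * ((Real.cos (∑ i : Fin 2, q i * ((x i).valMinAbs : ℝ)) : ℝ) : ℂ)) (WithLp.toLp 2 ![p.1, p.2])‖ ≤
      ∑' m : Fin 2 → ℤ, (if m ≠ 0 ∧ ∀ i, (L : ℤ) ∣ m i then
        ‖mFourierCoeff (Torus.descend
          (fun y : Momentum => (fun q : Momentum => ((Φ q : ℝ) : ℂ) * ((Real.cos (∑ i : Fin 2, q i * ((x i).valMinAbs : ℝ)) : ℝ) : ℂ)) ((2 * π) • y))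
          (isLatticePeriodic_rescale
            (Φ := fun q : Momentum => ((Φ q : ℝ) : ℂ) * ((Real.cos (∑ i : Fin 2, q i * ((x i).valMinAbs : ℝ)) : ℝ) : ℂ))
            (periodic_mul_cosSite (Φ := fun q : Momentum => ((Φ q : ℝ) : ℂ)) (periodic_ofReal_comp hper) x))) m‖ else 0) := by
  rw [torusCosCoeff_sample_eq_gridAvg]
  exact norm_latticeMomentumAvg_sub_zoneIntegral_le (contDiff_mul_cosSite (contDiff_ofReal_comp hΦ) x)
    (periodic_mul_cosSite (Φ := fun q : Momentum => ((Φ q : ℝ) : ℂ)) (periodic_ofReal_comp hper) x)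

end Poisson

end Summit.HubbardSuperconductivity.HubbardSuperconductivity.Theorems.EngineV8

end
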